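import Summits.ABC.ABC.Theorems.DefiniteXiSteinbergCoreXi7TailCore

/-!
# Xi helper 8 — generator of the Brandt eigenline, `XiCongruenceComparison` from the core (L7♮), the one-sided Frey valuation inequality `v_p r_{D.f} ≤ v_p deg D` (p ≥ 5) derived from ARS 2.1(b) (`padicValNat_congruenceNumber_le_padicValNat_deg_of_frey`) and `cps r_f ≤ cps deg D` (L6♭/L6′), and the registered stub from `XiCongruenceComparison` + (that inequality as a hypothesis, resp. the named fact ARS 2.1(b)) + `FreyModularity` (k1 G11 §1b–§3)

Helper module 8/10 for the registered stub `stub_xiDegreeComparison` of the line `p6_tamagawa_split` (crux `DefiniteXi.SteinbergCore`, item stmt-ABC-15024, route `route-ABC-DefiniteXi`).  Content = lines 2452–2508, 2530–2570, 2639–2822 of `Summits/ABC/ABC/Cruxes/SteinbergCore/STUB_IDEAS_stub_xiDegreeComparison_1_g44_XiMonoDefLight.lean` (gen-44 def-light edition of the critic monolith `STUB_PLAN_stub_xiDegreeComparison_XiMono.lean`) (the renamespaced k1 gen-11 certificate `STUB_IDEAS_stub_xiDegreeComparison_1_g11_Certificate.lean`: k1 gens 7–11, k2 gen-4 kernel,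 k3 gen-4 tail — authors: stub-ideation seats k1/k2/k3), cut mechanically at declaration boundaries by the stub-critic (plan `STUB-PLAN-stub_xiDegreeComparison.md` §1).  Proofs verbatim; nothing restated.
-/

set_option linter.dupNamespace false
set_option autoImplicit false

noncomputable section

namespace Summit.ABC.ABC.Theorems.SteinbergCoreXi.StubIdeasK1G11

open scoped MatrixGroups ModularForm Matrix
open CongruenceSubgroup
open Literature.NumberTheory.EllipticCurves Literature.NumberTheory.EllipticCurves.ModularForms
open Literature.NumberTheory.Automorphic Literature.NumberTheory.Automorphic.Brandt

variable {Nplus Nminus : ℕ}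

/-- **Generator helper (XS, PROVED).**  `brandtXi ≠ 0` ⟹ a setup `S` exists and, for any `Fintype`
structure on its class set, the eigen-lattice is a line `ℤφ` with `brandtXi = Σ_i w_i φ_i²`
(`XiSetup.brandtXi_eq_xi` — setup independence, PROVED in the tree; `xiOfOrder_eq`; `xi_eq_sum`;
contrapositive of `xi_of_not_isLine`; `brandtXi_of_isEmpty`). -/
theorem exists_generator_of_brandtXi_ne_zero {lam : ℕ → ℤ} (h : brandtXi Nplus Nminus lam ≠ 0) :
    ∃ S : XiSetup Nplus Nminus, ∀ [Fintype (ClassSet S.O)],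
      ∃ φ : ClassSet S.O → ℤ, φ ≠ 0 ∧ eigenLattice (Nplus * Nminus) (matrix S.O) lam = ℤ ∙ φ ∧
        brandtXi Nplus Nminus lam = ∑ i, weight S.O i * (φ i).natAbs ^ 2 := by
  by_cases hne : Nonempty (XiSetup Nplus Nminus)
  · obtain ⟨S⟩ := hne
    refine ⟨S, ?_⟩
    intro _inst
    have hxi : brandtXi Nplus Nminus lam =
        xi (weight S.O) (eigenLattice (Nplus * Nminus) (matrix S.O) lam) := by
      rw [S.brandtXi_eq_xi, XiSetup.xi, xiOfOrder_eq]
    by_cases hline : ∃ φ : ClassSet S.O → ℤ, φ ≠ 0 ∧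
        eigenLattice (Nplus * Nminus) (matrix S.O) lam = ℤ ∙ φ
    · obtain ⟨φ, hφ, hL⟩ := hline
      exact ⟨φ, hφ, hL, by rw [hxi, xi_eq_sum _ hφ hL]⟩
    · exact absurd (by rw [hxi]; exact xi_of_not_isLine _ hline) h
  · exact absurd (brandtXi_of_isEmpty (not_nonempty_iff.mp hne) lam) h

/-- **Guard (XS).**  The congruence number of the newform of an elliptic curve is `≠ 0`
(`r_f ∣ ∏_{P ≠ 𝕀_f} η_f(P) ≠ 0`, Pasten–Shimura §5.6; tree `congruenceNumber_dvd_prod_heckeCongruenceModulus`,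
`heckeCongruenceModulus_ne_zero` — the datum-free port of k2's `congruenceNumber_ne_zero`; the three inputs
`f ≠ 0`, `HasIntegralEigenvalues f`, `f ∈ S₂(Γ₀(N);ℤ)` are the proofs of `D.f_ne_zero`,
`D.hasIntegralEigenvalues_f`, `D.f_mem_integralCuspForms0` with `D.isNewformOf ↦ hf`). -/
theorem congruenceNumber_ne_zero_of_isNewformOf {N : ℕ} [NeZero N] {W : WeierstrassCurve ℚ}
    {f : CuspForm (Gamma0 N) 2} (hf : IsNewformOf W f) : congruenceNumber f ≠ 0 := by
  have hf0 : f ≠ 0 := by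
    intro h
    have h1 : (UpperHalfPlane.qExpansion 1 ⇑f).coeff 1 = 1 := hf.1.2.2
    rw [h, CuspForm.coe_zero, UpperHalfPlane.qExpansion_zero, map_zero] at h1
    exact zero_ne_one h1
  have hInt : HasIntegralEigenvalues f := by
    intro p hp _
    haveI : NeZero p := ⟨hp.ne_zero⟩
    obtain ⟨hnew, hcoeff⟩ := hf
    have heig := heckeT_eq_heckeEigenvalue_smul f p (hnew.2.1 p hp)
    have h1 := qExpansion_coeff_heckeT_holds N 2 f p hp 1
    have hcoe : ⇑(heckeT (Gamma0 N) 2 p f) = heckeEigenvalue f p • ⇑f := by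
      rw [heig]; rfl
    have hnorm : (UpperHalfPlane.qExpansion 1 ⇑f).coeff 1 = 1 := hnew.2.2
    rw [hcoe, ModularForm.qExpansion_smul one_pos (one_mem_strictPeriods_gamma0 N) _ f, map_smul,
      smul_eq_mul, hnorm, mul_one, mul_one, if_neg (Nat.Prime.not_dvd_one hp), mul_zero,
      ite_self, add_zero] at h1
    refine ⟨W.LFunction p, ?_⟩
    rw [heig, h1]
    exact congrArg (· • f) (hcoeff p)
  have hfL : f ∈ integralCuspForms0 N 2 := fun n ↦ ⟨W.LFunction n, (hf.2 n).symm⟩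
  intro h0
  have hdvd := congruenceNumber_dvd_prod_heckeCongruenceModulus hf.1 hInt hfL
  rw [h0, zero_dvd_iff, Finset.prod_eq_zero_iff] at hdvd
  obtain ⟨P, hP, hP0⟩ := hdvd
  exact heckeCongruenceModulus_ne_zero hInt hf0
    ((finite_minimalPrimes_anemicHeckeRing N 2).mem_toFinset.mp (Finset.mem_of_mem_erase hP))
    (Finset.ne_of_mem_erase hP) hP0
/-- **L7♮ — child 1♮ from the core (S · assembly; NO named fact).**  `C := 4 C₃` (L3).  Given the data and
`ξ ≠ 0`: generator `φ` of the chosen setup `S` (`exists_generator_of_brandtXi_ne_zero`), `r_f ≠ 0` (guard),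
`ℓ ∤ N = (N/Nm)·Nm` with `ℓ ≤ C₃ N^ε` (L3); L2 with `hcore := hX (N/Nm) Nm N _ S (freyCurve a b) f hf φ …`
(`S.xi = brandtXi` by `XiSetup.brandtXi_eq_xi`) gives `v_p ξ ≤ v_p r_f + v_p|a_ℓ − ℓ − 1|` for `p ≥ 5`;
L5 + L4: `cps ξ ≤ cps r_f · |a_ℓ − ℓ − 1| ≤ cps r_f · 4ℓ ≤ 4 C₃ N^ε cps r_f`. -/
theorem xiCongruenceComparison_of_core (hX : XiCoreDivisibility) : XiCongruenceComparison := by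
  intro ε hε
  obtain ⟨C₃, -, hC₃⟩ := exists_prime_not_dvd_le_rpow hε
  refine ⟨4 * C₃, fun a b hab h0 N _ hN Nm hodd hsq hcard hNmN hξ f hf => ?_⟩
  classical
  haveI := isElliptic_freyCurve h0
  obtain ⟨S, hS⟩ := exists_generator_of_brandtXi_ne_zero hξ
  letI : Fintype (ClassSet S.O) := Fintype.ofFinite _
  obtain ⟨φ, hφ0, hL, -⟩ := hS
  have hN' : N / Nm * Nm = N := Nat.div_mul_cancel hNmN
  have hr : congruenceNumber f ≠ 0 := congruenceNumber_ne_zero_of_isNewformOf hf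
  obtain ⟨ℓ, hℓ, hℓN, hℓle⟩ := hC₃ N (Nat.pos_of_ne_zero (NeZero.ne N))
  have hℓN' : ¬ ℓ ∣ N / Nm * Nm := by rwa [hN']
  have hcore := hX (N / Nm) Nm N hN' S (freyCurve a b) f hf φ hφ0 hL
  have hxS : S.xi (fun n => (freyCurve a b).LFunction n) =
      brandtXi (N / Nm) Nm (fun n => (freyCurve a b).LFunction n) := (S.brandtXi_eq_xi _).symm
  set ξ : ℕ := brandtXi (N / Nm) Nm (fun n => (freyCurve a b).LFunction n) with hξdef
  set r : ℕ := congruenceNumber f with hrdef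
  set e : ℕ := ((freyCurve a b).LFunction ℓ - (ℓ + 1)).natAbs with hedef
  have he : e ≠ 0 := natAbs_lFunction_sub_ne_zero (freyCurve a b) hℓ
  have hval : ∀ p : ℕ, p.Prime → 5 ≤ p →
      ξ.factorization p ≤ r.factorization p + e.factorization p := by
    intro p hp h5
    refine factorization_le_of_core S (freyCurve a b) hφ0 hL hr (x := ξ) ?_ hp h5 hℓ hℓN'
    intro i y hy
    have h := hcore i y hy
    rwa [hxS] at h
  have hL5 := primeToSix_le_mul_of_factorization_le hr he hval
  have hL4 : (e : ℝ) ≤ 4 * ℓ := natAbs_lFunction_sub_le (freyCurve a b) hℓ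
  have hcr0 : (0 : ℝ) ≤ ((r / (ordProj[2] r * ordProj[3] r) : ℕ) : ℝ) := Nat.cast_nonneg _
  calc ((ξ / (ordProj[2] ξ * ordProj[3] ξ) : ℕ) : ℝ)
      ≤ ((r / (ordProj[2] r * ordProj[3] r) * e : ℕ) : ℝ) := by exact_mod_cast hL5
    _ = ((r / (ordProj[2] r * ordProj[3] r) : ℕ) : ℝ) * (e : ℝ) := by rw [Nat.cast_mul]
    _ ≤ ((r / (ordProj[2] r * ordProj[3] r) : ℕ) : ℝ) * (4 * ℓ) := mul_le_mul_of_nonneg_left hL4 hcr0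
    _ ≤ ((r / (ordProj[2] r * ordProj[3] r) : ℕ) : ℝ) * (4 * (C₃ * (N : ℝ) ^ ε)) := by gcongr
    _ = 4 * C₃ * (N : ℝ) ^ ε * ((r / (ordProj[2] r * ordProj[3] r) : ℕ) : ℝ) := by ring
/-! ## §3  Back to the REGISTERED stub (Plan A: the two foreign inputs, named) -/

/-- `q² ∤ N(E_(a,b))` at every odd prime `q` (`N ∣ 2⁸ rad(ab(a+b))`, radical squarefree; copy of
`XiBound.Negative.not_sq_dvd_conductorNorm_freyCurve`). -/
theorem not_sq_dvd_conductorNorm_freyCurve_of_ne_two {a b : ℤ} (hab : IsCoprime a b)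
    (h0 : a * b * (a + b) ≠ 0) {q : ℕ} (hq : q.Prime) (hq2 : q ≠ 2) :
    ¬ q ^ 2 ∣ (freyCurve a b).conductorNorm ℤ := by
  intro hq2N
  have h' : q ^ 2 ∣ 2 ^ 8 * (UniqueFactorizationMonoid.radical (a * b * (a + b))).natAbs :=
    hq2N.trans (conductorNorm_freyCurve_dvd_holds a b hab h0)
  have hcop : Nat.Coprime (q ^ 2) (2 ^ 8) :=
    Nat.Coprime.pow _ _ ((Nat.coprime_primes hq Nat.prime_two).mpr hq2)
  have hr : q ^ 2 ∣ (UniqueFactorizationMonoid.radical (a * b * (a + b))).natAbs :=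
    hcop.dvd_of_dvd_mul_left h'
  have hsq : Squarefree (UniqueFactorizationMonoid.radical (a * b * (a + b))).natAbs :=
    Int.squarefree_natAbs.mpr UniqueFactorizationMonoid.squarefree_radical
  have hu : IsUnit (q : ℕ) := hsq q ((pow_two q) ▸ hr)
  exact hq.ne_one (Nat.isUnit_iff.mp hu)

-- `cps m ≤ cps n` for `m ∣ n ≠ 0` is the landed `Summit.ABC.ABC.Theorems.XiDegreeComparison.primeToSix_le_of_dvd`
-- (module `DefiniteXiSteinbergCoreXiDegreeComparison`, farm-stale today); re-derived inline inside L6′ below (`hcps`).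

/-- **H5♭ from the named fact ARS 2.1(b) (S, PROVED; the ONLY place minimality / optimality is used).**  For the
Frey curve, ANY datum `D` at its conductor and every prime `p ≥ 5`: `v_p(r_{D.f}) ≤ v_p(deg D)`.  Route:
`D₀ := D.exists_optimalDatum'` (same newform, `ker = ⊥`, minimal among same-newform data by
`modularDegree_le_of_isogenyMap_ker_eq_bot`), `deg D₀ ∣ deg D` (`modularDegree_eq_card_ker_mul`, template p139336
:286–299), `p² ∤ N` (`N ∣ 2⁸ rad`), ARS 2.1(b) at the optimal datum `D₀`.  (The one-sided inequality is a COROLLARY of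
the printed theorem, hence a theorem consuming the named fact — review p845198.) [cite: AgasheRibetStein2012, Thm. 2.1] -/
theorem padicValNat_congruenceNumber_le_padicValNat_deg_of_frey
    (hARS : padicValNat_congruenceNumber_eq_of_not_sq_dvd)
    {a b : ℤ} (hab : IsCoprime a b) (h0 : a * b * (a + b) ≠ 0) {N : ℕ} [NeZero N]
    (hN : (freyCurve a b).conductorNorm ℤ = N) (D : ModularParametrizationData (freyCurve a b) N)
    {p : ℕ} (hp : p.Prime) (h5 : 5 ≤ p) :
    padicValNat p (congruenceNumber D.f) ≤ padicValNat p D.modularDegree := by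
  haveI := isElliptic_freyCurve h0
  obtain ⟨W₀, hW₀, D₀, hf₀, h₀⟩ := D.exists_optimalDatum'
  haveI := hW₀
  have hker₀ : D₀.isogenyMap.ker = ⊥ := D₀.isogenyMap_ker_eq_bot_iff.mpr h₀
  have hmin₀ : ∀ (W₂ : WeierstrassCurve ℚ) [W₂.IsElliptic] (D₂ : ModularParametrizationData W₂ N),
      D₂.f = D₀.f → D₀.modularDegree ≤ D₂.modularDegree := fun W₂ _ D₂ hD₂ =>
    D₀.modularDegree_le_of_isogenyMap_ker_eq_bot hker₀ D₂ hD₂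
  have hdvd : D₀.modularDegree ∣ D.deg := by
    have hinj : Function.Injective D₀.isogenyMap := (AddMonoidHom.ker_eq_bot_iff _).mp hker₀
    obtain ⟨_, hdeg⟩ := D.modularDegree_eq_card_ker_mul hf₀.symm D₀.smul_periodLattice_le hinj
      D₀.deg_pos D₀.finite_setOf_natCard_fiberOrbits_ne
    exact ⟨_, hdeg.trans (mul_comm _ _)⟩
  have hd0 : D₀.modularDegree ≠ 0 := D₀.deg_pos.ne'
  have hsq : ¬ p ^ 2 ∣ N := by
    have h := not_sq_dvd_conductorNorm_freyCurve_of_ne_two hab h0 hp (by omega)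
    rwa [hN] at h
  have h := (hARS W₀ N D₀ hmin₀ p hp hsq).le
  rw [hf₀, ← Nat.factorization_def _ hp, ← Nat.factorization_def _ hp] at h
  rw [← Nat.factorization_def _ hp, ← Nat.factorization_def _ hp]
  exact h.trans (Finsupp.le_def.mp ((Nat.factorization_le_iff_dvd hd0 D.deg_pos.ne').mpr hdvd) p)

/-- **L6♭ (XS, PROVED from the one-sided Frey inequality as a HYPOTHESIS, spelled out).**  For the Frey curve and ANY
datum `D` at its conductor: `cps(r_{D.f}) ≤ cps(deg D)` (L5-type bookkeeping with `e = 1`).  The hypothesis `hF` is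
the weakest input the registered stub consumes (target of the optional ARS-free programme N1′, STUB-IDEAS k1 gen 17). -/
theorem primeToSix_congruenceNumber_le_primeToSix_deg_of_oneSided
    (hF : ∀ (a b : ℤ), IsCoprime a b → a * b * (a + b) ≠ 0 →
      ∀ (N : ℕ) [NeZero N], (freyCurve a b).conductorNorm ℤ = N →
      ∀ (D : ModularParametrizationData (freyCurve a b) N) (p : ℕ), p.Prime → 5 ≤ p →
        padicValNat p (congruenceNumber D.f) ≤ padicValNat p D.modularDegree)
    {a b : ℤ} (hab : IsCoprime a b) (h0 : a * b * (a + b) ≠ 0) {N : ℕ} [NeZero N]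
    (hN : (freyCurve a b).conductorNorm ℤ = N) (D : ModularParametrizationData (freyCurve a b) N) :
    congruenceNumber D.f / (ordProj[2] (congruenceNumber D.f) * ordProj[3] (congruenceNumber D.f)) ≤
      D.deg / (ordProj[2] D.deg * ordProj[3] D.deg) := by
  have hval : ∀ p : ℕ, p.Prime → 5 ≤ p → (congruenceNumber D.f).factorization p ≤
      D.deg.factorization p + (1 : ℕ).factorization p := by
    intro p hp h5
    have h := hF a b hab h0 N hN D p hp h5
    rw [← Nat.factorization_def _ hp, ← Nat.factorization_def _ hp] at h
    simpa [ModularParametrizationData.deg_eq_modularDegree] using h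
  calc congruenceNumber D.f / (ordProj[2] (congruenceNumber D.f) * ordProj[3] (congruenceNumber D.f))
      ≤ D.deg / (ordProj[2] D.deg * ordProj[3] D.deg) * 1 :=
        primeToSix_le_mul_of_factorization_le D.deg_pos.ne' one_ne_zero hval
    _ = D.deg / (ordProj[2] D.deg * ordProj[3] D.deg) := mul_one _

/-- **L6′ (S, PROVED from the named fact ARS 2.1(b)) — kept under its certificate name.**  For the Frey curve and ANY
datum `D` at its conductor: `cps(r_{D.f}) ≤ cps(deg D)`. [cite: AgasheRibetStein2012, Thm. 2.1] -/
theorem primeToSix_congruenceNumber_le_primeToSix_deg (hARS : padicValNat_congruenceNumber_eq_of_not_sq_dvd)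
    {a b : ℤ} (hab : IsCoprime a b) (h0 : a * b * (a + b) ≠ 0) {N : ℕ} [NeZero N]
    (hN : (freyCurve a b).conductorNorm ℤ = N) (D : ModularParametrizationData (freyCurve a b) N) :
    congruenceNumber D.f / (ordProj[2] (congruenceNumber D.f) * ordProj[3] (congruenceNumber D.f)) ≤
      D.deg / (ordProj[2] D.deg * ordProj[3] D.deg) :=
  primeToSix_congruenceNumber_le_primeToSix_deg_of_oneSided
    (fun _ _ hab' h0' _ _ hN' D' _ hp' h5' =>
      padicValNat_congruenceNumber_le_padicValNat_deg_of_frey hARS hab' h0' hN' D' hp' h5') hab h0 hN D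


/-- **Plan A assembly (PROVED from child 1♮ + L6♭): the REGISTERED stub, verbatim, from
`XiCongruenceComparison`, the Frey-only one-sided valuation inequality H5♭ and `FreyModularity`.**
`D` := a minimal datum (`exists_minimal_datum (hMod …)`), child 1♮ at `f := D.f`, L6♭, and `1 ≤ T³`. -/
theorem stub_of_xiCongruenceComparison_oneSided (h1 : XiCongruenceComparison)
    (hF : ∀ (a b : ℤ), IsCoprime a b → a * b * (a + b) ≠ 0 →
      ∀ (N : ℕ) [NeZero N], (freyCurve a b).conductorNorm ℤ = N →
      ∀ (D : ModularParametrizationData (freyCurve a b) N) (p : ℕ), p.Prime → 5 ≤ p →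
        padicValNat p (congruenceNumber D.f) ≤ padicValNat p D.modularDegree)
    (hMod : Summit.ABC.ABC.Theses.DefiniteXi.FreyModularity) :
    ∀ ε : ℝ, 0 < ε → ∃ C : ℝ, ∀ a b : ℤ, IsCoprime a b → a * b * (a + b) ≠ 0 → ∀ (N : ℕ) [NeZero N],
      (Literature.NumberTheory.EllipticCurves.freyCurve a b).conductorNorm ℤ = N →
      ∀ Nm : ℕ, Odd Nm → Squarefree Nm → Odd Nm.primeFactors.card → Nm ∣ N →
      Literature.NumberTheory.Automorphic.brandtXi (N / Nm) Nm
          (fun n => (Literature.NumberTheory.EllipticCurves.freyCurve a b).LFunction n) ≠ 0 →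
      ∃ D : Literature.NumberTheory.EllipticCurves.ModularForms.ModularParametrizationData
        (Literature.NumberTheory.EllipticCurves.freyCurve a b) N,
        (∀ D' : Literature.NumberTheory.EllipticCurves.ModularForms.ModularParametrizationData
          (Literature.NumberTheory.EllipticCurves.freyCurve a b) N, D.deg ≤ D'.deg) ∧
        ((Literature.NumberTheory.Automorphic.brandtXi (N / Nm) Nm
              (fun n => (Literature.NumberTheory.EllipticCurves.freyCurve a b).LFunction n) /
            (ordProj[2] (Literature.NumberTheory.Automorphic.brandtXi (N / Nm) Nm
                (fun n => (Literature.NumberTheory.EllipticCurves.freyCurve a b).LFunction n)) *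
              ordProj[3] (Literature.NumberTheory.Automorphic.brandtXi (N / Nm) Nm
                (fun n => (Literature.NumberTheory.EllipticCurves.freyCurve a b).LFunction n))) : ℕ) : ℝ) ≤
          C * (N : ℝ) ^ ε * ((D.deg / (ordProj[2] D.deg * ordProj[3] D.deg) : ℕ) : ℝ) *
            ((∏ q ∈ N.primeFactors, ((Literature.NumberTheory.EllipticCurves.freyCurve a b).minimalDiscriminantNorm
              ℤ).factorization q : ℕ) : ℝ) ^ 3 := by
  intro ε hε
  obtain ⟨C, hC⟩ := h1 ε hε
  refine ⟨max C 0, fun a b hab h0 N _ hN Nm hodd hsq hcard hNmN hξ => ?_⟩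
  haveI := isElliptic_freyCurve h0
  obtain ⟨D, -, hDmin⟩ := exists_minimal_datum (hMod a b hab h0 N hN)
  refine ⟨D, fun D' => hDmin D', ?_⟩
  set ξ : ℕ := brandtXi (N / Nm) Nm (fun n => (freyCurve a b).LFunction n) with hξdef
  set T : ℕ := ∏ q ∈ N.primeFactors, ((freyCurve a b).minimalDiscriminantNorm ℤ).factorization q with hTdef
  set r : ℕ := congruenceNumber D.f with hr
  have hcmp : ((ξ / (ordProj[2] ξ * ordProj[3] ξ) : ℕ) : ℝ) ≤
      C * (N : ℝ) ^ ε * ((r / (ordProj[2] r * ordProj[3] r) : ℕ) : ℝ) :=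
    hC a b hab h0 N hN Nm hodd hsq hcard hNmN hξ D.f D.isNewformOf
  have hL6 : ((r / (ordProj[2] r * ordProj[3] r) : ℕ) : ℝ) ≤
      ((D.deg / (ordProj[2] D.deg * ordProj[3] D.deg) : ℕ) : ℝ) := by
    exact_mod_cast primeToSix_congruenceNumber_le_primeToSix_deg_of_oneSided hF hab h0 hN D
  -- `1 ≤ T`, hence `1 ≤ T³`
  have hone : ∀ q ∈ N.primeFactors, 1 ≤ ((freyCurve a b).minimalDiscriminantNorm ℤ).factorization q :=
    fun q hq => factorization_minimalDiscriminantNorm_pos_of_dvd (freyCurve a b)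
      (Nat.prime_of_mem_primeFactors hq) (hN ▸ Nat.dvd_of_mem_primeFactors hq)
  have hT1 : (1 : ℝ) ≤ (T : ℝ) := by
    have : 1 ≤ T := Finset.one_le_prod' fun q hq => hone q hq
    exact_mod_cast this
  have hT3 : (1 : ℝ) ≤ (T : ℝ) ^ 3 := one_le_pow₀ hT1
  have hNε : (0 : ℝ) ≤ (N : ℝ) ^ ε := by positivity
  calc ((ξ / (ordProj[2] ξ * ordProj[3] ξ) : ℕ) : ℝ)
      ≤ C * (N : ℝ) ^ ε * ((r / (ordProj[2] r * ordProj[3] r) : ℕ) : ℝ) := hcmp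
    _ ≤ max C 0 * (N : ℝ) ^ ε * ((r / (ordProj[2] r * ordProj[3] r) : ℕ) : ℝ) := by
        have h0' : (0 : ℝ) ≤ (N : ℝ) ^ ε * ((r / (ordProj[2] r * ordProj[3] r) : ℕ) : ℝ) := by positivity
        calc C * (N : ℝ) ^ ε * ((r / (ordProj[2] r * ordProj[3] r) : ℕ) : ℝ)
            = C * ((N : ℝ) ^ ε * ((r / (ordProj[2] r * ordProj[3] r) : ℕ) : ℝ)) := by ring
          _ ≤ max C 0 * ((N : ℝ) ^ ε * ((r / (ordProj[2] r * ordProj[3] r) : ℕ) : ℝ)) :=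
              mul_le_mul_of_nonneg_right (le_max_left _ _) h0'
          _ = _ := by ring
    _ ≤ max C 0 * (N : ℝ) ^ ε * ((D.deg / (ordProj[2] D.deg * ordProj[3] D.deg) : ℕ) : ℝ) := by gcongr
    _ = max C 0 * (N : ℝ) ^ ε * ((D.deg / (ordProj[2] D.deg * ordProj[3] D.deg) : ℕ) : ℝ) * 1 := by ring
    _ ≤ max C 0 * (N : ℝ) ^ ε * ((D.deg / (ordProj[2] D.deg * ordProj[3] D.deg) : ℕ) : ℝ) * (T : ℝ) ^ 3 := by
        gcongr

/-- **Plan A assembly from the named fact — kept under its certificate name**: the REGISTERED stub, verbatim, from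
`XiCongruenceComparison`, ARS 2.1(b) (`padicValNat_congruenceNumber_eq_of_not_sq_dvd`) and `FreyModularity`.
[cite: AgasheRibetStein2012, Thm. 2.1] -/
theorem stub_of_xiCongruenceComparison (h1 : XiCongruenceComparison)
    (hARS : padicValNat_congruenceNumber_eq_of_not_sq_dvd)
    (hMod : Summit.ABC.ABC.Theses.DefiniteXi.FreyModularity) :
    ∀ ε : ℝ, 0 < ε → ∃ C : ℝ, ∀ a b : ℤ, IsCoprime a b → a * b * (a + b) ≠ 0 → ∀ (N : ℕ) [NeZero N],
      (Literature.NumberTheory.EllipticCurves.freyCurve a b).conductorNorm ℤ = N →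
      ∀ Nm : ℕ, Odd Nm → Squarefree Nm → Odd Nm.primeFactors.card → Nm ∣ N →
      Literature.NumberTheory.Automorphic.brandtXi (N / Nm) Nm
          (fun n => (Literature.NumberTheory.EllipticCurves.freyCurve a b).LFunction n) ≠ 0 →
      ∃ D : Literature.NumberTheory.EllipticCurves.ModularForms.ModularParametrizationData
        (Literature.NumberTheory.EllipticCurves.freyCurve a b) N,
        (∀ D' : Literature.NumberTheory.EllipticCurves.ModularForms.ModularParametrizationData
          (Literature.NumberTheory.EllipticCurves.freyCurve a b) N, D.deg ≤ D'.deg) ∧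
        ((Literature.NumberTheory.Automorphic.brandtXi (N / Nm) Nm
              (fun n => (Literature.NumberTheory.EllipticCurves.freyCurve a b).LFunction n) /
            (ordProj[2] (Literature.NumberTheory.Automorphic.brandtXi (N / Nm) Nm
                (fun n => (Literature.NumberTheory.EllipticCurves.freyCurve a b).LFunction n)) *
              ordProj[3] (Literature.NumberTheory.Automorphic.brandtXi (N / Nm) Nm
                (fun n => (Literature.NumberTheory.EllipticCurves.freyCurve a b).LFunction n))) : ℕ) : ℝ) ≤
          C * (N : ℝ) ^ ε * ((D.deg / (ordProj[2] D.deg * ordProj[3] D.deg) : ℕ) : ℝ) *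
            ((∏ q ∈ N.primeFactors, ((Literature.NumberTheory.EllipticCurves.freyCurve a b).minimalDiscriminantNorm
              ℤ).factorization q : ℕ) : ℝ) ^ 3 :=
  stub_of_xiCongruenceComparison_oneSided h1
    (fun _ _ hab h0 _ _ hN D _ hp h5 =>
      padicValNat_congruenceNumber_le_padicValNat_deg_of_frey hARS hab h0 hN D hp h5) hMod

end Summit.ABC.ABC.Theorems.SteinbergCoreXi.StubIdeasK1G11

end
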